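import Summits.Ventures.HSemireg.WedgeHankelModel
import Summits.Ventures.HSemireg.FormulaNStatement

/-!
# Venture HSemireg — THEOREM H (4/4): closed form of the recursion and the glue to th-6's HankelLaw

HONEST FRAMING. Part of the Lean index of the computation cell `pub-hsemireg` (seat p3; Sunday enclosure of the
FORMULA-N kernel assets of seats th-7 / th-6, ENCLOSURE-PLAN-p3.md).  Finite-dimensional exterior algebra over a field ONLY:
no variety, no cohomology theory, no semiregularity map is constructed here; nothing here says that HC / HC_CM / HC_AV holds;
no Literature fact is declared or used.  The geometric DICTIONARY (why these ranks are the `HT`-side box ranks of the cell's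
STRUCTURE.md §1 / theory/FORMULA-N.md) lives in theory/FORMULA-N-th7.md PART B §A.3 / §N and is NOT asserted in Lean.

THEOREM H, file 4 of 4 (th-7 HankelRank.lean l.1148–1259 + l.1326–1450): the CLOSED FORM of the recursion, `w_eq_G : w_m(q) =
G_m(q) := Σ_{S ⊆ range m} q_{|S|} • Π_{a<m} (y_a if a ∈ S else x_a)` and `G_top` (= th-6's `vClass` after reindexing), and the GLUE to
th-6's typed statements (`FormulaNStatement.lean`): the reindexing `Fin n ⊕ Fin n ≃ Fin (n+n)` induces an algebra isomorphism `Φ` with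
`Φ(∂_a) = x_a`, `Φ(dz̄_a) = y_a`, `Φ_vClass : Φ (vClass q) = w_n(q)`; ranks are `Φ`-invariant; th-6's `hankel k q` is `hankel1 k q`
recast (`rank_hankel_eq`).  RESULTS: **`hankelLawAt (hk : k ≤ n) (q) : FormulaN.HankelLawAt K n k q`** and **`hankelLaw :
FormulaN.HankelLaw`** — conjunct 1 of th-6's `FN4_classLevel`, for every field (its `CharZero` hypothesis is not used).  th-7's
statements and proofs, unchanged (namespaces `HSemiregHankel`/`HSemiregHankelGlue` ↦ `Summit.Ventures.HSemireg.Wedge.Hankel`,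
`HSemiregFormulaN` ↦ `Summit.Ventures.HSemireg.FormulaN`).
-/

open Module Set Set.powersetCard

namespace Summit.Ventures.HSemireg.Wedge.Hankel

variable (K : Type*) [Field K] {I : Type*} [LinearOrder I] [Fintype I]

section Model

section Unfold

variable (n : ℕ)

/-- `G_m(q) = Σ_{S ⊆ [m]} q_{|S|} · Π_{a<m} (y_a if a ∈ S else x_a)` (ordered product, `a` increasing). -/
noncomputable def G (m : ℕ) (q : ℕ → K) : HT K (In n) :=
  ∑ S ∈ (Finset.range m).powerset,
    q S.card • ((List.range m).map fun a => if a ∈ S then Y K n a else X K n a).prod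

variable {n}

/-- `G_0(q) = q_0 · 1`. -/
lemma G_zero (q : ℕ → K) : G K n 0 q = q 0 • (1 : HT K (In n)) := by
  simp [G]

omit [Field K] in
/-- changing the test set by an element not in the list does not change the ordered product. -/
lemma prod_map_ite_insert {A : Type*} [Monoid A] (u v : ℕ → A) {a : ℕ} {l : List ℕ} (ha : a ∉ l)
    (S : Finset ℕ) :
    (l.map fun b => if b ∈ insert a S then v b else u b).prod =
      (l.map fun b => if b ∈ S then v b else u b).prod := by
  congr 1
  apply List.map_congr_left
  intro b hb
  have hba : b ≠ a := fun h => ha (h ▸ hb)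
  simp [Finset.mem_insert, hba]

/-- the recursion satisfied by the closed form: `G_{m+1}(q) = G_m(q) x_m + G_m(σq) y_m`. -/
lemma G_succ (m : ℕ) (q : ℕ → K) :
    G K n (m + 1) q = G K n m q * X K n m + G K n m (shift K q) * Y K n m := by
  have hm : m ∉ Finset.range m := Finset.notMem_range_self
  have hml : m ∉ List.range m := by simp
  have hdisj : Disjoint (Finset.range m).powerset ((Finset.range m).powerset.image (insert m)) := by
    rw [Finset.disjoint_left]
    intro S hS hS'
    obtain ⟨S', -, rfl⟩ := Finset.mem_image.mp hS'
    exact hm (Finset.mem_powerset.mp hS (Finset.mem_insert_self m S'))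
  have hinj : Set.InjOn (fun S : Finset ℕ => insert m S) ((Finset.range m).powerset : Set (Finset ℕ)) := by
    intro S hS S' hS' h
    have haS : m ∉ S := fun h' => hm (Finset.mem_powerset.mp (Finset.mem_coe.mp hS) h')
    have haS' : m ∉ S' := fun h' => hm (Finset.mem_powerset.mp (Finset.mem_coe.mp hS') h')
    have h' : insert m S = insert m S' := h
    rw [← Finset.erase_insert haS, h', Finset.erase_insert haS']
  rw [G, G, G, Finset.range_add_one, Finset.powerset_insert, Finset.sum_union hdisj, Finset.sum_image hinj,
    Finset.sum_mul, Finset.sum_mul]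
  congr 1
  · apply Finset.sum_congr rfl
    intro S hS
    have hmS : m ∉ S := fun h' => hm (Finset.mem_powerset.mp hS h')
    rw [List.range_succ, List.map_append, List.prod_append, List.map_singleton, List.prod_singleton,
      if_neg hmS, smul_mul_assoc]
  · apply Finset.sum_congr rfl
    intro S hS
    have hmS : m ∉ S := fun h' => hm (Finset.mem_powerset.mp hS h')
    rw [List.range_succ, List.map_append, List.prod_append, List.map_singleton, List.prod_singleton,
      if_pos (Finset.mem_insert_self m S), prod_map_ite_insert _ _ hml, Finset.card_insert_of_notMem hmS,
      smul_mul_assoc, shift_apply]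

/-- the recursion `w` computes the closed form `G`. -/
theorem w_eq_G (m : ℕ) (q : ℕ → K) : w K n m q = G K n m q := by
  induction m generalizing q with
  | zero => rw [w, G_zero]
  | succ m ih => rw [w, ih, ih, G_succ]

/-- a generator monomial is `ι` of the corresponding basis vector. -/
lemma gx_eq_ι (i : In n) : gx K i = ExteriorAlgebra.ι K (b K (In n) i) := by
  rw [gx, B, ExteriorAlgebra.basis_apply_ofCard (b K (In n)) (Finset.card_singleton i)]
  simp [ExteriorAlgebra.ιMulti_family, ExteriorAlgebra.ιMulti_apply, ofFinEmbEquiv_symm_apply]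

/-- `X a` for `a : Fin n` is the generator `e_{castAdd n a}`. -/
lemma X_fin (a : Fin n) : X K n a = ExteriorAlgebra.ι K (b K (In n) (Fin.castAdd n a)) := by
  rw [X, dif_pos a.2, gx_eq_ι]
  rfl

/-- `Y a` for `a : Fin n` is the generator `e_{natAdd n a}`. -/
lemma Y_fin (a : Fin n) : Y K n a = ExteriorAlgebra.ι K (b K (In n) (Fin.natAdd n a)) := by
  rw [Y, dif_pos a.2, gx_eq_ι]
  rfl

/-- the closed form at `m = n`, indexed by subsets of `Fin n` and graded by cardinality
(this is the shape of th-6's `vClass`). -/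
theorem G_top (q : ℕ → K) :
    G K n n q = ∑ m ∈ Finset.range (n + 1), q m •
      ∑ T ∈ (Finset.univ : Finset (Fin n)).powersetCard m,
        ((List.finRange n).map fun a =>
          if a ∈ T then ExteriorAlgebra.ι K (b K (In n) (Fin.natAdd n a))
          else ExteriorAlgebra.ι K (b K (In n) (Fin.castAdd n a))).prod := by
  have hr : Finset.range n = (Finset.univ : Finset (Fin n)).map Fin.valEmbedding := by
    rw [Fin.map_valEmbedding_univ, Nat.Iio_eq_range]
  rw [G, Finset.powerset_card_disjiUnion, Finset.sum_disjiUnion, Finset.card_range]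
  apply Finset.sum_congr rfl
  intro m _
  rw [hr, Finset.powersetCard_map, Finset.sum_map, Finset.smul_sum]
  apply Finset.sum_congr rfl
  intro T hT
  rw [RelEmbedding.coe_toEmbedding, Finset.mapEmbedding_apply, Finset.card_map,
    (Finset.mem_powersetCard.mp hT).2]
  congr 1
  rw [← List.map_coe_finRange_eq_range, List.map_map]
  congr 1
  apply List.map_congr_left
  intro a _
  have hmem : ((a : ℕ) ∈ T.map Fin.valEmbedding) ↔ a ∈ T := Finset.mem_map' Fin.valEmbedding
  simp only [Function.comp_apply, hmem]
  split_ifs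
  · exact Y_fin K a
  · exact X_fin K a

end Unfold

end Model

/-! ## Part 3 — GLUE: th-6's `HankelLawAt` for every field and every `k ≤ n`, hence `HankelLaw`, PROVED.
Route: the reindexing `Fin n ⊕ Fin n ≃ Fin (n+n)` induces an algebra isomorphism `Φ` of exterior algebras with
`Φ(∂_a) = x_a`, `Φ(dz̄_a) = y_a`; `Φ(vClass q) = w_n(q)` by the closed form `G_top`; ranks are `Φ`-invariant;
th-6's `hankel k q` is `hankel1 k q` with the column index recast (`n - k + 1 = n + 1 - k` for `k ≤ n`) and `s+j = j+s`. -/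

variable (n : ℕ)

/-- reindexing `Fin n ⊕ Fin n → K ≃ Fin (n+n) → K` (`inl a ↦ castAdd n a`, `inr a ↦ natAdd n a`). -/
noncomputable def eN : FormulaN.N K n ≃ₗ[K] (In n → K) :=
  LinearEquiv.funCongrLeft K K (finSumFinEquiv.symm : Fin (n + n) ≃ Fin n ⊕ Fin n)

/-- `eN f j = f (finSumFinEquiv.symm j)`. -/
lemma eN_apply (f : FormulaN.N K n) (j : Fin (n + n)) :
    eN K n f j = f (finSumFinEquiv.symm j) := rfl

/-- `eN` sends the generator `inl a` to `castAdd n a`. -/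
lemma eN_single_inl (a : Fin n) :
    eN K n (Pi.single (Sum.inl a) (1 : K)) = Pi.single (Fin.castAdd n a) 1 := by
  ext j
  rw [eN_apply, Pi.single_apply, Pi.single_apply]
  have : finSumFinEquiv.symm j = Sum.inl a ↔ j = Fin.castAdd n a := by
    rw [Equiv.symm_apply_eq]; exact Iff.rfl
  simp only [this]

/-- `eN` sends the generator `inr a` to `natAdd n a`. -/
lemma eN_single_inr (a : Fin n) :
    eN K n (Pi.single (Sum.inr a) (1 : K)) = Pi.single (Fin.natAdd n a) 1 := by
  ext j
  rw [eN_apply, Pi.single_apply, Pi.single_apply]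
  have : finSumFinEquiv.symm j = Sum.inr a ↔ j = Fin.natAdd n a := by
    rw [Equiv.symm_apply_eq]; exact Iff.rfl
  simp only [this]

/-- the reindexing as an isometry of the ZERO quadratic forms. -/
noncomputable def isoQ :
    (0 : QuadraticForm K (FormulaN.N K n)).IsometryEquiv (0 : QuadraticForm K (In n → K)) :=
  { eN K n with map_app' := fun m => by simp }

/-- the induced algebra isomorphism of exterior algebras. -/
noncomputable def Φ : FormulaN.HT K n ≃ₐ[K] HT K (In n) :=
  CliffordAlgebra.equivOfIsometry (isoQ K n)

/-- `Φ` on generators is `eN`. -/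
lemma Φ_ι (m : FormulaN.N K n) :
    Φ K n (ExteriorAlgebra.ι K m) = ExteriorAlgebra.ι K (eN K n m) := by
  rw [Φ, CliffordAlgebra.equivOfIsometry_apply]
  show CliffordAlgebra.map _ (CliffordAlgebra.ι _ m) = CliffordAlgebra.ι _ _
  rw [CliffordAlgebra.map_apply_ι]
  rfl

/-- `Φ (∂_a) = e_{castAdd n a}`. -/
lemma Φ_x (a : Fin n) :
    Φ K n (FormulaN.x K n a) = ExteriorAlgebra.ι K (b K (In n) (Fin.castAdd n a)) := by
  rw [FormulaN.x, Φ_ι, eN_single_inl, b, Pi.basisFun_apply]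

/-- `Φ (dz̄_a) = e_{natAdd n a}`. -/
lemma Φ_y (a : Fin n) :
    Φ K n (FormulaN.y K n a) = ExteriorAlgebra.ι K (b K (In n) (Fin.natAdd n a)) := by
  rw [FormulaN.y, Φ_ι, eN_single_inr, b, Pi.basisFun_apply]

/-- **KEY IDENTIFICATION:** the reindexing carries th-6's class `vClass q = Σ_m q_m E_m` to th-7's recursively
defined `w_n(q)` (closed form `G_top` + `w_eq_G`). -/
theorem Φ_vClass (q : ℕ → K) : Φ K n (FormulaN.vClass K n q) = w K n n q := by
  rw [w_eq_G, G_top, FormulaN.vClass, map_sum]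
  apply Finset.sum_congr rfl
  intro m _
  rw [map_smul, FormulaN.elemClass, map_sum]
  congr 1
  apply Finset.sum_congr rfl
  intro S _
  rw [map_list_prod, List.map_map]
  congr 1
  apply List.map_congr_left
  intro a _
  simp only [Function.comp_apply]
  split_ifs
  · exact Φ_y K n a
  · exact Φ_x K n a

/-- `Φ` maps the generators onto the generators. -/
lemma map_Φ_range_ι :
    Submodule.map (Φ K n).toLinearMap (LinearMap.range (ExteriorAlgebra.ι K : FormulaN.N K n →ₗ[K] _)) =
      LinearMap.range (ExteriorAlgebra.ι K : (In n → K) →ₗ[K] _) := by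
  rw [← LinearMap.range_comp]
  have h : (Φ K n).toLinearMap ∘ₗ (ExteriorAlgebra.ι K : FormulaN.N K n →ₗ[K] _) =
      (ExteriorAlgebra.ι K : (In n → K) →ₗ[K] _) ∘ₗ (eN K n).toLinearMap := by
    refine LinearMap.ext fun m => ?_
    simp only [LinearMap.coe_comp, Function.comp_apply, LinearEquiv.coe_coe]
    exact Φ_ι K n m
  rw [h, LinearMap.range_comp_of_range_eq_top _ (LinearEquiv.range (eN K n))]

/-- `Φ` maps `⋀^k` onto `⋀^k`. -/
lemma map_Φ_exteriorPower (k : ℕ) :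
    Submodule.map (Φ K n).toLinearMap (⋀[K]^k (FormulaN.N K n)) = ⋀[K]^k (In n → K) := by
  show Submodule.map (Φ K n).toAlgHom.toLinearMap (LinearMap.range (ExteriorAlgebra.ι K) ^ k) =
    LinearMap.range (ExteriorAlgebra.ι K) ^ k
  rw [Submodule.map_pow, show (Φ K n).toAlgHom.toLinearMap = (Φ K n).toLinearMap from rfl, map_Φ_range_ι]

/-- `Φ` carries the range of th-6's `wedgeWith k q` onto the range of `wedge k (Φ (vClass q))`. -/
lemma map_Φ_range_wedgeWith (k : ℕ) (q : ℕ → K) :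
    Submodule.map (Φ K n).toLinearMap (LinearMap.range (FormulaN.wedgeWith K n k q)) =
      LinearMap.range (wedge K n k (Φ K n (FormulaN.vClass K n q))) := by
  rw [FormulaN.wedgeWith, wedge, LinearMap.range_comp, LinearMap.range_comp,
    Submodule.range_subtype, Submodule.range_subtype, ← map_Φ_exteriorPower K n k, ← Submodule.map_comp,
    ← Submodule.map_comp]
  congr 1
  refine LinearMap.ext fun x => ?_
  simp only [LinearMap.coe_comp, Function.comp_apply, LinearMap.mulRight_apply, AlgEquiv.toLinearMap_apply,
    map_mul]

/-- th-6's `hankel k q` (columns `Fin (n-k+1)`, entry `q_{s+j}`) has the rank of `hankel1 k q` for `k ≤ n`. -/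
lemma rank_hankel_eq {k : ℕ} (hk : k ≤ n) (q : ℕ → K) :
    (FormulaN.hankel K n k q).rank = (hankel1 K n k q).rank := by
  have h : hankel1 K n k q =
      (FormulaN.hankel K n k q).submatrix (Equiv.refl _) (finCongr (by omega : n + 1 - k = n - k + 1)) := by
    ext i s
    simp [hankel1, FormulaN.hankel, add_comm]
  rw [h, Matrix.rank_submatrix]

/-- **th-6's `HankelLawAt`, PROVED** for every field `K` (any characteristic), every `n`, every `k ≤ n`,
every coefficient sequence `q`. -/
theorem hankelLawAt {k : ℕ} (hk : k ≤ n) (q : ℕ → K) : FormulaN.HankelLawAt K n k q := by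
  unfold FormulaN.HankelLawAt
  have h1 : Module.finrank K (LinearMap.range (FormulaN.wedgeWith K n k q)) =
      Module.finrank K (Submodule.map (Φ K n).toLinearMap (LinearMap.range (FormulaN.wedgeWith K n k q))) :=
    (LinearEquiv.finrank_map_eq (Φ K n).toLinearEquiv _).symm
  rw [h1, map_Φ_range_wedgeWith, Φ_vClass, hankelLaw_model, rank_hankel_eq K n hk]

/-- **th-6's `HankelLaw` (conjunct 1 of `FN4_classLevel`), PROVED.** (The `CharZero` hypothesis of the
statement is not used.) Conjuncts 2 and 3 are `HSemiregGlue.FN4_transversePair_clause` /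
`HSemiregGlue.FN4_pointPair_clause` in theory/th7/PointPairGlue.lean v2. -/
theorem hankelLaw : FormulaN.HankelLaw :=
  fun K _ _ n _ q hk => hankelLawAt K n hk q

end Summit.Ventures.HSemireg.Wedge.Hankel
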